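import Summits.Ventures.PercRepro.SevenThreeLineTable
import Summits.Ventures.PercRepro.SevenThreeCycCount
import Summits.Ventures.PercRepro.SevenThreeStarTransfer

/-!
# PercRepro — the `(7,3)` cell: the line table's class recursion as a subset sum (p3, gen 16)

The line table (`SevenThreeLineTable.lean`) sums `Lc·[bracket]` over the choices of points from the classes of
`W`-points on a line by the structural recursion `classSum`. This file identifies the recursion with the subset sum:
for a list `L` of pairwise disjoint finsets (the classes),
`classSum k ℓ₀ Lt (L.map card) sz hit mult = mult · Σ_{Z₁ ⊆ ⋃L} Σ_{z_ℓ ≤ ℓ₀} C(ℓ₀, z_ℓ)·bracketN k ℓ₀ Lt (sz + |Z₁|) z_ℓ (hit + hitsL L Z₁)`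
(`classSum_eq_sum`), with `hitsL` of `SevenThreeCycCount.lean`. Also the zero-padding invariance of `classSum` /
`deltaN` (`deltaN_append_zeros`) and the cast of the line table's `phiTermN`. Mathlib + the tables only.
-/

namespace PercRepro

namespace SevenThree

namespace LineCount

open Finset CycCount

variable {α : Type*} [DecidableEq α]

/-- `sumTo n f = Σ_{v ∈ range (n + 1)} f v` for the line table's `sumTo`. -/
theorem sumTo_eq_sum (n : ℕ) (f : ℕ → ℤ) : LineTable.sumTo n f = ∑ v ∈ Finset.range (n + 1), f v := by
  induction n with
  | zero => simp [LineTable.sumTo]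
  | succ n ih => rw [LineTable.sumTo, ih, Finset.sum_range_succ _ (n + 1)]

/-- `loopSum` as a range sum with the multiplicity factored out. -/
theorem loopSum_eq (k l0 Lt sz hit : ℕ) (mult : ℤ) :
    LineTable.loopSum k l0 Lt sz hit mult =
      mult * ∑ zl ∈ Finset.range (l0 + 1), (Nat.choose l0 zl : ℤ) * LineTable.bracketN k l0 Lt sz zl hit := by
  unfold LineTable.loopSum
  rw [sumTo_eq_sum, Finset.mul_sum]
  apply Finset.sum_congr rfl
  intro zl _
  ring

/-- The unfiltered split of a sum over the subsets of a disjoint union. -/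
theorem sum_powerset_union {β : Type*} [AddCommMonoid β] {N U : Finset α} (hNU : Disjoint N U) (f : Finset α → β) :
    ∑ C ∈ (N ∪ U).powerset, f C = ∑ A ∈ N.powerset, ∑ B ∈ U.powerset, f (A ∪ B) := by
  have := sum_filter_powerset_union hNU (fun _ => True) f
  simp only [Finset.filter_true_of_mem (fun _ _ => trivial)] at this
  exact this

/-- **The class recursion as a subset sum**: for a list `L` of pairwise disjoint finsets,
`classSum k ℓ₀ Lt (L.map card) sz hit mult = mult · Σ_{Z₁ ⊆ ⋃L} Σ_{z_ℓ} C(ℓ₀, z_ℓ)·bracketN k ℓ₀ Lt (sz + |Z₁|) z_ℓ (hit + hitsL L Z₁)`. -/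
theorem classSum_eq_sum (k l0 Lt : ℕ) (L : List (Finset α)) (hL : L.Pairwise Disjoint) (sz hit : ℕ) (mult : ℤ) :
    LineTable.classSum k l0 Lt (L.map Finset.card) sz hit mult =
      mult * ∑ Z ∈ (unionL L).powerset, ∑ zl ∈ Finset.range (l0 + 1),
        (Nat.choose l0 zl : ℤ) * LineTable.bracketN k l0 Lt (sz + Z.card) zl (hit + hitsL L Z) := by
  induction L generalizing sz hit mult with
  | nil =>
    rw [List.map_nil, LineTable.classSum, unionL_nil, Finset.powerset_empty, Finset.sum_singleton, loopSum_eq]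
    simp [hitsL_nil]
  | cons N L ih =>
    have hL' : L.Pairwise Disjoint := hL.of_cons
    have hd := disjoint_of_pairwise_cons hL
    have hNU := disjoint_unionL_of_pairwise_cons hL
    rw [List.map_cons, LineTable.classSum, sumTo_eq_sum, unionL_cons, sum_powerset_union hNU]
    -- the inner sums depend on `A ⊆ N` only through `|A|`
    have hinner : ∀ A ∈ N.powerset, ∑ B ∈ (unionL L).powerset, ∑ zl ∈ Finset.range (l0 + 1),
        (Nat.choose l0 zl : ℤ) * LineTable.bracketN k l0 Lt (sz + (A ∪ B).card) zl (hit + hitsL (N :: L) (A ∪ B)) =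
        ∑ B ∈ (unionL L).powerset, ∑ zl ∈ Finset.range (l0 + 1),
        (Nat.choose l0 zl : ℤ) * LineTable.bracketN k l0 Lt (sz + A.card + B.card) zl
          (hit + (if A.card = 0 then 0 else 1) + hitsL L B) := by
      intro A hA
      rw [Finset.mem_powerset] at hA
      apply Finset.sum_congr rfl
      intro B hB
      rw [Finset.mem_powerset] at hB
      have hAB : Disjoint A B := (hNU.mono_left hA).mono_right hB
      have hBN : Disjoint B N := hNU.symm.mono_left hB
      rw [Finset.card_union_of_disjoint hAB, hitsL_cons, hitsL_union_of_subset hd hA, union_inter_eq_left hA hBN]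
      have h1 : (if A.Nonempty then 1 else 0) = (if A.card = 0 then 0 else 1) := by
        by_cases hne : A.Nonempty
        · rw [if_pos hne, if_neg (Finset.card_pos.2 hne).ne']
        · rw [if_neg hne, if_pos (Finset.card_eq_zero.2 (Finset.not_nonempty_iff_eq_empty.1 hne))]
      rw [h1, add_assoc, add_assoc]
    rw [Finset.sum_congr rfl hinner]
    rw [Finset.sum_powerset_apply_card (fun a => ∑ B ∈ (unionL L).powerset, ∑ zl ∈ Finset.range (l0 + 1),
        (Nat.choose l0 zl : ℤ) * LineTable.bracketN k l0 Lt (sz + a + B.card) zl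
          (hit + (if a = 0 then 0 else 1) + hitsL L B))]
    rw [Finset.mul_sum]
    apply Finset.sum_congr rfl
    intro z _
    rw [ih hL' (sz + z) (hit + if z = 0 then 0 else 1) (mult * (Nat.choose N.card z : ℤ)), nsmul_eq_mul]
    ring

/-- `classSum` ignores a class of size `0`. -/
theorem classSum_zero_cons (k l0 Lt : ℕ) (cs : List ℕ) (sz hit : ℕ) (mult : ℤ) :
    LineTable.classSum k l0 Lt (0 :: cs) sz hit mult = LineTable.classSum k l0 Lt cs sz hit mult := by
  show LineTable.sumTo 0 (fun z => LineTable.classSum k l0 Lt cs (sz + z) (hit + if z = 0 then 0 else 1)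
    (mult * (Nat.choose 0 z : ℤ))) = LineTable.classSum k l0 Lt cs sz hit mult
  simp [LineTable.sumTo]

/-- `classSum` ignores trailing zeros. -/
theorem classSum_append_zeros (k l0 Lt : ℕ) (cs : List ℕ) (n : ℕ) :
    ∀ (sz hit : ℕ) (mult : ℤ),
      LineTable.classSum k l0 Lt (cs ++ List.replicate n 0) sz hit mult = LineTable.classSum k l0 Lt cs sz hit mult := by
  induction cs with
  | nil =>
    intro sz hit mult
    rw [List.nil_append]
    induction n generalizing sz hit mult with
    | zero => rfl
    | succ n ih => rw [List.replicate_succ, classSum_zero_cons, ih]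
  | cons c cs ih =>
    intro sz hit mult
    rw [List.cons_append]
    unfold LineTable.classSum
    congr 1
    funext z
    exact ih _ _ _

/-- `deltaN` ignores trailing zeros. -/
theorem deltaN_append_zeros (k l0 : ℕ) (cs : List ℕ) (n : ℕ) :
    LineTable.deltaN k l0 (cs ++ List.replicate n 0) = LineTable.deltaN k l0 cs := by
  unfold LineTable.deltaN
  rw [List.sum_append, List.sum_replicate, smul_zero, add_zero, classSum_append_zeros]

/-- `C(x + 3, 3) ∣ Lc` for `x ≤ 3` (restated). -/
theorem choose_dvd_Lc' (x : ℕ) (hx : x ≤ 3) : (Nat.choose (x + 3) 3 : ℤ) ∣ LineTable.Lc :=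
  LineTable.choose_dvd_Lc x (by omega)

/-- `Lc > 0`. -/
theorem Lc_pos : (0 : ℤ) < LineTable.Lc := by decide

/-- The cast of the line table's `phiTermN`. -/
theorem phiTermN_cast (x : ℕ) :
    ((LineTable.phiTermN x : ℤ) : ℚ) = if x ≤ 3 then (LineTable.Lc : ℚ) / ((Nat.choose (x + 3) 3 : ℕ) : ℚ) else 0 := by
  unfold LineTable.phiTermN
  by_cases hx : x ≤ 3
  · have hc : ((Nat.choose (x + 3) 3 : ℤ) : ℚ) ≠ 0 := by
      have := Nat.choose_pos (by omega : 3 ≤ x + 3)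
      exact_mod_cast this.ne'
    rw [if_pos hx, if_pos hx, Int.cast_div (choose_dvd_Lc' x hx) hc]
    push_cast
    rfl
  · rw [if_neg hx, if_neg hx, Int.cast_zero]

/-- The box facts of the line table unpacked: for `a ≤ 7`, `1 ≤ x ≤ 4`, `DlineN a x ∣ Lc` and `0 < DlineN a x`. -/
theorem DlineN_box {a x : ℕ} (ha : a ≤ 7) (hx1 : 1 ≤ x) (hx4 : x ≤ 4) :
    LineTable.DlineN a x ∣ LineTable.Lc ∧ 0 < LineTable.DlineN a x := by
  have h1 := LineTable.dvd_Lc_of_box a (by omega) x (by omega)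
  have h2 := LineTable.DlineN_pos_of_box a (by omega) x (by omega)
  rw [Bool.or_eq_true, Bool.not_eq_true', decide_eq_false_iff_not, decide_eq_true_eq] at h1 h2
  rcases h1 with h1 | h1
  · omega
  rcases h2 with h2 | h2
  · omega
  exact ⟨h1, h2⟩

end LineCount

end SevenThree

end PercRepro
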